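import Summits.ValiantsHypothesis.ValiantsHypothesis.Theorems.KPlusLogSqLawOctaveDefs

/-!
# Route «KPlusLogSqLaw», octave line — file 2/7: Ω-Θ is a THEOREM (Tavenas' roots sit one per pair of octaves) and the corollaries `valiant_of_octave*`

HONEST FRAMING.  Octave line of ideator seat val-idea-6 (crux-idea `octave-lifting` on stmt-ValiantsHypothesis-19561, critic-1 PASS 2026-08-27), published as `Cruxes/WeakLifting/Lines/octave.lean`; landed in Theorems shape by prover seat val-width-19561-oc1 (`--supports stmt-ValiantsHypothesis-19561`).  Conjecture B (`KPlusLogSqLaw`), `TropicalB` (stmt-19771), `WeakLifting` (stmt-19561), `MatrixDescartes` (stmt-18050) and the octave statements `OctaveWeakLifting` / `OctaveKLaw` / `OctaveMatrixDescartes` are OPEN and DEFINED, never asserted; nothing in this file proves any of them, and VP ≠ VNP is not moved.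

This file: `le_octaveCount_of_alternating_xPt`, `octaveThetaWitness_proof : OctaveThetaWitness`, and the conditional deciding theorems `valiant_of_octaveMatrixDescartes'`, `valiant_of_octaveKLaw`, `valiant_of_tropicalB_of_octaveWeakLifting` (hypotheses = the OPEN octave statements).
-/

set_option linter.dupNamespace false
set_option autoImplicit false

namespace Summit.ValiantsHypothesis.ValiantsHypothesis.Theorems.KPlusLogSqLaw.Octave

open Polynomial Finset
open scoped BigOperators
open Summit.ValiantsHypothesis.ValiantsHypothesis.Theorems.LacunarySymmetroidMatrixDescartes (RealRootLawAt KPlusLogSqLaw)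
open Summit.ValiantsHypothesis.ValiantsHypothesis.Theses.LacunarySymmetroid (MatrixDescartes PencilTransfer ThetaWitness)
open Summit.ValiantsHypothesis.ValiantsHypothesis.Theses.KPlusLogSqLaw (TropicalB WeakLifting)

/-! ## Ω-Θ is a THEOREM: Tavenas' roots sit one per (pair of) octaves -/

section OctaveWitness

open Literature.Computability.AlgebraicComplexity (tavenasV xPt xPt_succ_lt sign_eval_xPt map_tavenasV_ne_zero)

/-- Tavenas' sample points are negative. [folklore] -/
theorem xPt_neg (N u : ℕ) : xPt N u < 0 := by
  unfold xPt
  exact div_neg_of_neg_of_pos (neg_neg_of_pos (by positivity)) (by positivity)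

/-- `-x_u = 2^{4u+2-2N}`. [folklore] -/
theorem neg_xPt_eq_zpow (N u : ℕ) : -xPt N u = (2 : ℝ) ^ ((4 * u + 2 : ℤ) - 2 * N) := by
  have h4 : (4 : ℝ) = 2 ^ 2 := by norm_num
  rw [xPt, neg_div, neg_neg, h4, ← pow_mul, ← pow_mul, zpow_sub₀ (by norm_num : (2 : ℝ) ≠ 0),
    show ((4 * u + 2 : ℤ)) = ((2 * (2 * u + 1) : ℕ) : ℤ) by push_cast; ring,
    show ((2 * N : ℤ)) = ((2 * N : ℕ) : ℤ) by push_cast; ring, zpow_natCast, zpow_natCast]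

/-- **Octave form of the alternation-to-roots lemma at Tavenas' points**: sign alternation of `p ≠ 0` at
`x_0 > x_1 > … > x_M` (`x_u = -4^{2u+1}/4^N`) yields `M` real roots in `M` DISTINCT dyadic octaves, because the
interval `(x_{u+1}, x_u)` has absolute values in `(2^{4u+2-2N}, 2^{4u+6-2N})`. [folklore] -/
theorem le_octaveCount_of_alternating_xPt (p : ℝ[X]) (hp : p ≠ 0) (N M : ℕ)
    (hs : ∀ u, u ≤ M → 0 < (-1 : ℝ) ^ u * p.eval (xPt N u)) : M ≤ octaveCount p := by
  classical
  have hx : ∀ u, xPt N (u + 1) < xPt N u := xPt_succ_lt N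
  have hroot : ∀ u, u < M → ∃ r, xPt N (u + 1) < r ∧ r < xPt N u ∧ p.IsRoot r := by
    intro u hu
    have h0 := hs u hu.le
    have h1 := hs (u + 1) hu
    rw [pow_succ] at h1
    have hcont := p.continuousOn (s := Set.Icc (xPt N (u + 1)) (xPt N u))
    rcases neg_one_pow_eq_or ℝ u with h | h
    · rw [h] at h0 h1
      have ha : p.eval (xPt N (u + 1)) < 0 := by linarith
      have hb : 0 < p.eval (xPt N u) := by linarith
      obtain ⟨r, hr, hr0⟩ := intermediate_value_Ioo (hx u).le hcont ⟨ha, hb⟩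
      exact ⟨r, hr.1, hr.2, hr0⟩
    · rw [h] at h0 h1
      have ha : 0 < p.eval (xPt N (u + 1)) := by linarith
      have hb : p.eval (xPt N u) < 0 := by linarith
      obtain ⟨r, hr, hr0⟩ := intermediate_value_Ioo' (hx u).le hcont ⟨hb, ha⟩
      exact ⟨r, hr.1, hr.2, hr0⟩
  choose! r hr using hroot
  have hrneg : ∀ u, u < M → r u < 0 := fun u hu => (hr u hu).2.1.trans (xPt_neg N u)
  have hup : ∀ u, u < M → octave (r u) < (4 * u + 6 : ℤ) - 2 * N := by
    intro u hu
    have hpos : 0 < |r u| := abs_pos.2 (hrneg u hu).ne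
    have h1 : |r u| < (2 : ℝ) ^ ((4 * u + 6 : ℤ) - 2 * N) := by
      rw [abs_of_neg (hrneg u hu)]
      have e := neg_xPt_eq_zpow N (u + 1)
      have e' : ((4 * ((u + 1 : ℕ) : ℤ) + 2 : ℤ)) - 2 * N = (4 * u + 6 : ℤ) - 2 * N := by push_cast; ring
      rw [e'] at e
      linarith [(hr u hu).1]
    have h1' : |r u| < ((2 : ℕ) : ℝ) ^ ((4 * u + 6 : ℤ) - 2 * N) := by rwa [Nat.cast_ofNat]
    exact (Int.lt_zpow_iff_log_lt (b := 2) (by norm_num) hpos).1 h1'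
  have hlow : ∀ v, v < M → (4 * v + 2 : ℤ) - 2 * N ≤ octave (r v) := by
    intro v hv
    have hpos : 0 < |r v| := abs_pos.2 (hrneg v hv).ne
    have h1 : (2 : ℝ) ^ ((4 * v + 2 : ℤ) - 2 * N) ≤ |r v| := by
      rw [abs_of_neg (hrneg v hv), ← neg_xPt_eq_zpow N v]
      linarith [(hr v hv).2.1]
    have h1' : ((2 : ℕ) : ℝ) ^ ((4 * v + 2 : ℤ) - 2 * N) ≤ |r v| := by rwa [Nat.cast_ofNat]
    exact (Int.zpow_le_iff_le_log (b := 2) (by norm_num) hpos).1 h1'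
  have hinj : Set.InjOn (fun u => octave (r u)) (range M : Set ℕ) := by
    intro u hu v hv huv
    have hu' : u < M := by simpa using hu
    have hv' : v < M := by simpa using hv
    simp only at huv
    by_contra hne
    rcases lt_or_gt_of_ne hne with h | h
    · have a := hup u hu'
      have b := hlow v hv'
      have hz : (u : ℤ) + 1 ≤ v := by exact_mod_cast h
      omega
    · have a := hup v hv'
      have b := hlow u hu'
      have hz : (v : ℤ) + 1 ≤ u := by exact_mod_cast h
      omega
  have hsub : (range M).image (fun u => octave (r u)) ⊆ (p.roots.toFinset.filter (fun x => x ≠ 0)).image octave := by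
    intro y hy
    obtain ⟨u, hu, rfl⟩ := mem_image.1 hy
    have hu' : u < M := by simpa using hu
    refine mem_image.2 ⟨r u, ?_, rfl⟩
    rw [mem_filter, Multiset.mem_toFinset, mem_roots hp]
    exact ⟨(hr u hu').2.2, (hrneg u hu').ne⟩
  calc M = ((range M).image (fun u => octave (r u))).card := by rw [card_image_of_injOn hinj, card_range]
    _ ≤ _ := card_le_card hsub

/-- `V_n` has real roots in at least `2^n - 1` distinct dyadic octaves. [cite: Tavenas2014, Lemme 3.36] -/
theorem le_octaveCount_map_tavenasV (n : ℕ) :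
    2 ^ n - 1 ≤ octaveCount ((tavenasV n).map (Int.castRingHom ℝ)) := by
  refine le_octaveCount_of_alternating_xPt _ (map_tavenasV_ne_zero n) (2 ^ n) _ fun u hu => sign_eval_xPt n u ?_
  have := Nat.one_le_two_pow (n := n)
  omega

end OctaveWitness

end Summit.ValiantsHypothesis.ValiantsHypothesis.Theorems.KPlusLogSqLaw.Octave

/-! ### the witness family (verbatim copy of `thetaWitness_proof`, last three lines replaced by the octave count) -/

namespace Summit.ValiantsHypothesis.ValiantsHypothesis.Theorems.KPlusLogSqLaw.Octave

open MvPolynomial Literature.Computability.AlgebraicComplexity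
open Summit.ValiantsHypothesis.ValiantsHypothesis.Theses.KPlusLogSqLaw (TropicalB WeakLifting)
open Summit.ValiantsHypothesis.ValiantsHypothesis.Theorems.SymmetroidDescartes
  (isProjection_map complexity_pow_le totalDegree_aeval_le_mul eval_map_tavenas_h)
open Summit.ValiantsHypothesis.ValiantsHypothesis.Theorems.FeketeSOSSOSMagnification
  (isVNPFamily_of_levelwise' boolSum_aeval_sumElim)
open Summit.ValiantsHypothesis.ValiantsHypothesis.Theorems.LacunarySymmetroid
  (isVNPFamily_aeval_of_isPBounded isVNPFamily_map_of_isProjection_perPoly exists_digitSubst)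

/-- **Ω-Θ holds** with Tavenas' witness of `thetaWitness_proof` (same `Θ`, same `d`, `n₀ = 1`). [cite: Tavenas2014, Lemme 3.36, Cor. 3.37] -/
theorem octaveThetaWitness_proof : OctaveThetaWitness := by
  unfold OctaveThetaWitness
  obtain ⟨q, hq, hh⟩ := Tavenas2014_cor_3_37_holds
  choose h hproj _ hsub using hh
  choose g hgcx hgdeg hgev using fun n : ℕ =>
    exists_digitSubst n (2 * (n * Nat.log 2 n) + 3) (2 * Nat.log 2 n + 3) (Nat.succ_pos _)
  refine ⟨fun n => aeval (g n) (MvPolynomial.map (algebraMap ℚ ℝ) (h (n * Nat.log 2 n))),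
    fun n i => 2 ^ ((2 * Nat.log 2 n + 3) * (i : ℕ)), ?_, 1, fun n hn => ?_⟩
  · /- VNP: the complexification is the substituted family over `ℂ` -/
    have hβ : ∀ n : ℕ, 2 ^ (2 * Nat.log 2 n + 3) ≤ 8 * (n * n) + 8 := by
      intro n
      rcases Nat.eq_zero_or_pos n with rfl | hn
      · simp
      · have h1 : 2 ^ Nat.log 2 n ≤ n := Nat.pow_log_le_self 2 hn.ne'
        calc 2 ^ (2 * Nat.log 2 n + 3) = 8 * (2 ^ Nat.log 2 n * 2 ^ Nat.log 2 n) := by ring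
          _ ≤ 8 * (n * n) + 8 := by nlinarith [Nat.mul_le_mul h1 h1]
    have hmap : ∀ n : ℕ, MvPolynomial.map (algebraMap ℝ ℂ)
        (aeval (g n) (MvPolynomial.map (algebraMap ℚ ℝ) (h (n * Nat.log 2 n)))) =
        aeval (fun v => MvPolynomial.map (algebraMap ℝ ℂ) (g n v))
          (MvPolynomial.map (algebraMap ℚ ℂ) (h (n * Nat.log 2 n))) := by
      intro n
      rw [aeval_eq_bind₁, aeval_eq_bind₁, map_bind₁, map_map]
      congr 2
    simp only [hmap]
    have hlog : IsPBounded (Nat.log 2) := IsPBounded.id.mono fun n => Nat.log_le_self 2 n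
    have hν : IsPBounded fun n => n * Nat.log 2 n := IsPBounded.mul_holds IsPBounded.id hlog
    have hB : IsPBounded fun n => (n + 2 * (2 * (n * Nat.log 2 n) + 3)) * (8 * (n * n) + 8) :=
      IsPBounded.mul_holds
        (IsPBounded.add_holds IsPBounded.id (IsPBounded.mul_holds (IsPBounded.const 2)
          (IsPBounded.add_holds (IsPBounded.mul_holds (IsPBounded.const 2) hν) (IsPBounded.const 3))))
        (IsPBounded.add_holds (IsPBounded.mul_holds (IsPBounded.const 8)
          (IsPBounded.mul_holds IsPBounded.id IsPBounded.id)) (IsPBounded.const 8))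
    refine isVNPFamily_aeval_of_isPBounded
      (σ := fun n => Fin (2 * (n * Nat.log 2 n) + 3) ⊕ Fin (2 * (n * Nat.log 2 n) + 3))
      (τ := fun n => Fin n)
      (isVNPFamily_map_of_isProjection_perPoly (σ := fun n =>
          Fin (2 * (n * Nat.log 2 n) + 3) ⊕ Fin (2 * (n * Nat.log 2 n) + 3))
        (q := fun n => q (n * Nat.log 2 n)) (IsPBounded.comp_holds hq hν) ?_
        (fun n => h (n * Nat.log 2 n)) fun n => hproj (n * Nat.log 2 n))
      (fun n v => MvPolynomial.map (algebraMap ℝ ℂ) (g n v)) hB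
      (fun n => ?_) (fun n => ?_) (fun n v => ?_)
    · -- number of variables of `h_ν`
      refine (IsPBounded.add_holds (IsPBounded.add_holds (IsPBounded.mul_holds (IsPBounded.const 2) hν)
        (IsPBounded.const 3)) (IsPBounded.add_holds (IsPBounded.mul_holds (IsPBounded.const 2) hν)
        (IsPBounded.const 3))).mono fun n => ?_
      rw [Fintype.card_sum, Fintype.card_fin]
    · -- number of variables of `Θ_n`
      rw [Fintype.card_fin]
      have : 1 ≤ 8 * (n * n) + 8 := by omega
      calc n ≤ n + 2 * (2 * (n * Nat.log 2 n) + 3) := Nat.le_add_right _ _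
        _ = (n + 2 * (2 * (n * Nat.log 2 n) + 3)) * 1 := (mul_one _).symm
        _ ≤ _ := Nat.mul_le_mul_left _ this
    · -- total cost of the substitution
      calc ∑ v, complexity (MvPolynomial.map (algebraMap ℝ ℂ) (g n v))
          ≤ ∑ _v : Fin (2 * (n * Nat.log 2 n) + 3) ⊕ Fin (2 * (n * Nat.log 2 n) + 3),
              2 ^ (2 * Nat.log 2 n + 3) := Finset.sum_le_sum fun v _ => hgcx n v
        _ = (2 * (2 * (n * Nat.log 2 n) + 3)) * 2 ^ (2 * Nat.log 2 n + 3) := by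
          rw [Finset.sum_const, Finset.card_univ, Fintype.card_sum, Fintype.card_fin, smul_eq_mul]
          ring
        _ ≤ (n + 2 * (2 * (n * Nat.log 2 n) + 3)) * (8 * (n * n) + 8) :=
          Nat.mul_le_mul (Nat.le_add_left _ _) (hβ n)
    · -- degrees of the substituted values
      calc (MvPolynomial.map (algebraMap ℝ ℂ) (g n v)).totalDegree ≤ 2 ^ (2 * Nat.log 2 n + 3) :=
            hgdeg n v
        _ ≤ 8 * (n * n) + 8 := hβ n
        _ = 1 * (8 * (n * n) + 8) := (one_mul _).symm
        _ ≤ (n + 2 * (2 * (n * Nat.log 2 n) + 3)) * (8 * (n * n) + 8) :=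
          Nat.mul_le_mul_right _ (by omega)
  · /- roots: the restriction along `y_i = X^{2^{β i}}` is `V_ν`, `ν = n ⌊log₂ n⌋` -/
    have hm : 2 * (n * Nat.log 2 n) + 3 ≤ (2 * Nat.log 2 n + 3) * n := by nlinarith
    have hP : aeval (fun i : Fin n => (Polynomial.X : Polynomial ℝ) ^ 2 ^ ((2 * Nat.log 2 n + 3) * (i : ℕ)))
        (aeval (g n) (MvPolynomial.map (algebraMap ℚ ℝ) (h (n * Nat.log 2 n)))) =
        (tavenasV (n * Nat.log 2 n)).map (Int.castRingHom ℝ) := by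
      apply Polynomial.funext
      intro x
      rw [← eval_map_tavenas_h (hsub (n * Nat.log 2 n)) x, ← Polynomial.coe_aeval_eq_eval,
        comp_aeval_apply, comp_aeval_apply, MvPolynomial.aeval_eq_eval]
      have hF : (fun v => aeval (fun i : Fin n => Polynomial.aeval x
            ((Polynomial.X : Polynomial ℝ) ^ 2 ^ ((2 * Nat.log 2 n + 3) * (i : ℕ)))) (g n v)) =
          Sum.elim (fun j : Fin (2 * (n * Nat.log 2 n) + 3) => x ^ 2 ^ (j : ℕ))
            (fun i : Fin (2 * (n * Nat.log 2 n) + 3) => (2 : ℝ) ^ 2 ^ (i : ℕ)) := by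
        funext v
        rw [← hgev n hm x v, MvPolynomial.aeval_eq_eval]
        have hpt : (fun i : Fin n => Polynomial.aeval x
            ((Polynomial.X : Polynomial ℝ) ^ 2 ^ ((2 * Nat.log 2 n + 3) * (i : ℕ)))) =
            fun i : Fin n => x ^ 2 ^ ((2 * Nat.log 2 n + 3) * (i : ℕ)) := by
          funext i
          simp only [map_pow, Polynomial.aeval_X]
        rw [hpt]
      rw [hF]
    rw [hP]
    have hr := le_octaveCount_map_tavenasV (n * Nat.log 2 n)
    have h1 : 1 ≤ 2 ^ (n * Nat.log 2 n) := Nat.one_le_two_pow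
    omega
/-! ## Corollaries: each octave law ALONE decides Valiant (given the tree's closed items) -/

/-- Ω-MDR ⇒ VP_ℂ ≠ VNP_ℂ (octave MatrixDescartes suffices; weaker than stmt-18050). -/
theorem valiant_of_octaveMatrixDescartes' (h : OctaveMatrixDescartes) : _root_.ValiantsHypothesis :=
  valiant_of_octaveMatrixDescartes h octaveThetaWitness_proof

/-- Ω-B ⇒ VP_ℂ ≠ VNP_ℂ (the octave `K + log² m` law suffices; weaker than Conjecture B). -/
theorem valiant_of_octaveKLaw (h : OctaveKLaw) : _root_.ValiantsHypothesis :=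
  valiant_of_octaveMatrixDescartes' (octaveMatrixDescartes_of_octaveKLaw h)

/-- **TB ∧ Ω-W ⇒ VP_ℂ ≠ VNP_ℂ** — the line's deciding theorem with only OPEN hypotheses left:
crux `TropicalB` (stmt-19771) and the NEW, WEAKER crux `OctaveWeakLifting` (replaces `WeakLifting` stmt-19561). -/
theorem valiant_of_tropicalB_of_octaveWeakLifting (hT : TropicalB) (hΩW : OctaveWeakLifting) :
    _root_.ValiantsHypothesis :=
  valiant_of_octave hT hΩW octaveThetaWitness_proof

end Summit.ValiantsHypothesis.ValiantsHypothesis.Theorems.KPlusLogSqLaw.Octave
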